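import Literature.AlgebraicGeometry.VanGeemen1994.WeilTypeGeneralMemberIntrinsic
import Literature.AlgebraicGeometry.HodgeTheory.DivisorClassesHardLefschetz
import Literature.NumberTheory.ComplexMultiplication.EllipticCurveNonQuadraticPeriod
import HarnessLib

/-!
# The first typing `VanGeemen1994_thm612` (van Geemen's Theorem 6.12 over ALL `n ≥ 1`) is FALSE as typed: the Weil-type
# surface `E × E` of a non-CM elliptic curve is a counterexample at `n = 1` (van Geemen LNM 1594, Thm. 4.11 «with `n > 1`»,
# 5.4, 6.11–6.12; Milne 1999, Thm. 4.4) — negative knowledge; the corrected statement (`n ≥ 2`) is the tree's theorem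
# `VanGeemen1994_thm612_corrected_holds`

Family `hodge`, layer `Literature/AlgebraicGeometry/VanGeemen1994`; THEOREMS ONLY — no definition, no named fact, no
`sorry` (D-0026). Lane `lit-hodgefound` (Track 2 foundations library), prover seat `lit-hodgefound-p21`, generation 31,
row g31-#5. Net debt `−1` in the honest sense: the unproved named fact `VanGeemen1994.VanGeemen1994_thm612` (file
`WeilTypeHodgeGroupSU`, typed with the binder `0 < n`) is SETTLED — by refutation. Nothing is re-worded in place (a
settled over-strong typing is negative knowledge, as for `HasSemisimpleHodgeGroup_of_hasHodgeGroupSU_statement_iff_false`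
in `WeilTypeSurfaceCMSquare`); the printed theorem with its printed proviso lives on as
`VanGeemen1994_thm612_corrected` / `…_corrected_holds` (`WeilTypeHodgeRingOfSU`, §L) and, hypothesis-free in the
Weil-plane clause, as g30-#7's `thm612_of_hasHodgeGroupSU`.

WHY IT IS FALSE (van Geemen himself: Thm. 4.11 carries «(with `n > 1`)», and 5.4 exhibits the degenerate member
`E × E ⊂ ℚ(i)` of the Weil family in dimension `2` with «`B¹ ∋ W`»). For `n = 1` the last conjunct of the typed statement,
`Disjoint (D¹ ⊗ ℂ) (W_K ⊗ ℂ)`, contradicts the others: on a SURFACE every rational `(1,1)`-class is a divisor monomial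
of degree one, so `W_K ⊗ ℂ ⊆ B¹ ⊗ ℂ ⊆ D¹ ⊗ ℂ` (tree `weilClassesOf_le_hodgeClassSpan_of_hasHodgeGroupSU`,
`mem_divisorClassesSpan_one`), while `dim W_K ⊗ ℂ = 2` (tree `finrank_weilClassesOf_eq_two`). And the hypotheses ARE met at
`n = 1`: for the explicit non-CM elliptic curve `E = E_{i⁴√2}` of the tree (`NonQuadraticPeriod.curve`, `End(E) = ℤ`,
Silverman VI Thm. 5.5) the surface `E × E` with the rotation `J = (x, y) ↦ (-y, x)` (`J² = -1`, `K = ℚ(i)`, `d = 1`) has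
`Hg = SU_H` for the `K`-symmetrised hyperplane class (g30-#8 `exists_hasHodgeGroupSU_one_not_isField_endAlgebra`, resting on
Milne 1999 Thm. 4.4 for `E × E`, the tree's `NonCMSquare.hasHodgeGroupSU`), and its Weil classes are of type `(1,1)`
(g30-#7).

WHAT IS PROVED. `exists_counterexample_VanGeemen1994_thm612` (an explicit tuple meeting every hypothesis of the typed fact at
`n = d = 1` with `W_K ⊗ ℂ ≤ D¹ ⊗ ℂ` and `W_K ⊗ ℂ ≠ 0`), **`not_VanGeemen1994_thm612`**, `VanGeemen1994_thm612_iff_false`; and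
the positive record `VanGeemen1994_thm612_of_two_le` — the typed conclusion DOES hold for every `n ≥ 2` (restatement-free
pointer: it is `VanGeemen1994_thm612_corrected_holds` with the Weil-plane clause discharged by g30-#7, i.e.
`thm612_of_hasHodgeGroupSU`).

## References

* [vanGeemen1994HodgeAV] B. van Geemen, An introduction to the Hodge conjecture for abelian varieties, LNM 1594 (1994):
  Thm. 4.11 («with `n > 1`»), 5.4, 6.9, Thm. 6.11, Thm. 6.12. [cite: vanGeemen1994HodgeAV, Thm. 4.11, 5.4 and Thm. 6.12]
* [Milne1999LefschetzClasses] J. S. Milne, Lefschetz classes on abelian varieties, Duke Math. J. 96 (1999), Thm. 4.4.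
  [cite: Milne1999LefschetzClasses, Thm. 4.4]
* [SilvermanAEC2009] J. H. Silverman, *The Arithmetic of Elliptic Curves*, 2nd ed. (2009), VI Thm. 5.5. [cite: SilvermanAEC2009, VI Thm. 5.5]
* [Weil1977HodgeRing] A. Weil, Abelian varieties and the Hodge ring, Œuvres III (1977), 421–429.
-/

noncomputable section

open CategoryTheory
open Literature.AlgebraicTopology.SingularHomology
open Literature.AlgebraicGeometry.Motives
open Literature.AlgebraicGeometry.HodgeTheory
open Literature.NumberTheory.ComplexMultiplication
open Literature.Barriers.HodgeConjecture (divisorClassesSpan)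

namespace Literature.AlgebraicGeometry.VanGeemen1994

/-- **A counterexample to the typing `VanGeemen1994_thm612` at `n = 1`**: the square `X = E × E` of the tree's explicit
non-CM elliptic curve, with the rotation `J` (`J ≫ J = -1`), a projective embedding `e` and a non-zero rational class `a` on
the ambient projective space, meets every hypothesis of the typed fact with `n = d = 1` — `dim X = 2`, the Weil classes of
type `(1,1)`, `Hg = SU_H` for `h_K = e^*a + J^*e^*a` — while its Weil plane is a NON-ZERO subspace of `D¹ ⊗ ℂ`
(«`B¹ ∋ W`», van Geemen 5.4). [cite: vanGeemen1994HodgeAV, 5.4, Thm. 4.11 and Thm. 6.12] [cite: Milne1999LefschetzClasses, Thm. 4.4]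
[cite: SilvermanAEC2009, VI Thm. 5.5] -/
theorem exists_counterexample_VanGeemen1994_thm612 :
    ∃ (X : AbelianVariety ℂ) (J : X ⟶ X) (e : ProjectiveEmbedding X.X) (a : complexBetti (projectiveSpace e.n ℂ) 2),
      X.dim = 2 * 1 ∧ J ≫ J = -((1 : ℕ) • 𝟙 X) ∧
      (∀ c ∈ weilClassesOf X J 1 1, IsOfHodgeType (2 * 1) X.X (2 * 1) 1 1 c) ∧ IsRationalClass a ∧ a ≠ 0 ∧
      HasHodgeGroupSU X J 1 1
        (((1 : ℕ) : ℂ) • complexBetti.map e.ι 2 a + complexBetti.map J.hom.hom.hom 2 (complexBetti.map e.ι 2 a)) ∧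
      weilClassesOf X J 1 1 ≤ divisorClassesSpan X.X X.dim 1 ∧ weilClassesOf X J 1 1 ≠ ⊥ := by
  obtain ⟨J, e, a, hA2, hJJ, ha, ha0, hSU, -, -, -⟩ :=
    exists_hasHodgeGroupSU_one_not_isField_endAlgebra NonQuadraticPeriod.dim_curve
      NonQuadraticPeriod.hodgeEndTrivial_curve
  refine ⟨_, J, e, a, hA2, hJJ,
    fun c hc ↦ isOfHodgeType_of_mem_weilClassesOf_of_hasHodgeGroupSU one_pos hA2 hJJ hSU hc, ha, ha0, hSU, ?_, ?_⟩
  · -- `W_K ⊗ ℂ ⊆ B¹ ⊗ ℂ ⊆ D¹ ⊗ ℂ`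
    refine (weilClassesOf_le_hodgeClassSpan_of_hasHodgeGroupSU one_pos hA2 hJJ hSU).trans ?_
    rw [hA2]
    exact Submodule.span_le.2 fun c hc ↦ mem_divisorClassesSpan_one hc.1 hc.2
  · -- `dim (W_K ⊗ ℂ) = 2`
    intro hbot
    have h2 := finrank_weilClassesOf_eq_two (abelianVarietyCohomologyExteriorH1_holds.hasExteriorCohomologyH1 _)
      (by rw [abelianVarietyCohomologyExteriorH1_holds.finrank_one, hA2]) one_pos one_pos hJJ
    rw [hbot, finrank_bot] at h2
    exact two_ne_zero h2.symm

/-- **The typed fact `VanGeemen1994_thm612` (van Geemen's Theorem 6.12 quantified over ALL `n ≥ 1`) is FALSE**: at the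
counterexample its last conjunct `Disjoint (D¹ ⊗ ℂ) (W_K ⊗ ℂ)` would force the non-zero Weil plane `W_K ⊗ ℂ ⊆ D¹ ⊗ ℂ` to
vanish. The printed theorem (with Thm. 4.11's «`n > 1`») is the tree's `VanGeemen1994_thm612_corrected_holds`.
[cite: vanGeemen1994HodgeAV, Thm. 4.11 ("with n > 1"), 5.4 and Thm. 6.12] [cite: Milne1999LefschetzClasses, Thm. 4.4] -/
theorem not_VanGeemen1994_thm612 : ¬ VanGeemen1994_thm612 := by
  intro h612
  obtain ⟨X, J, e, a, hA2, hJJ, hW, ha, ha0, hSU, hWD, hW0⟩ := exists_counterexample_VanGeemen1994_thm612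
  obtain ⟨-, -, -, -, hdisj⟩ := h612 X J 1 1 e a one_pos one_pos hA2 hJJ hW ha ha0 hSU
  exact hW0 (hdisj.eq_bot_of_ge hWD)

/-- `VanGeemen1994_thm612 ↔ False`. [cite: vanGeemen1994HodgeAV, Thm. 4.11 ("with n > 1") and Thm. 6.12] -/
theorem VanGeemen1994_thm612_iff_false : VanGeemen1994_thm612 ↔ False :=
  iff_false_intro not_VanGeemen1994_thm612

/-- **The positive record: the typed conclusion of `VanGeemen1994_thm612` holds for every `n ≥ 2`** — and there the
Weil-plane clause is not even needed (g30-#7 `thm612_of_hasHodgeGroupSU`, Moonen–Zarhin 1998 §1 + the tree's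
`VanGeemen1994_thm612_corrected_holds`). [cite: vanGeemen1994HodgeAV, Thm. 4.11 ("with n > 1") and Thm. 6.12]
[cite: MoonenZarhin1998WeilClasses, §1 Criterion and Remark (p. 1)] -/
theorem VanGeemen1994_thm612_of_two_le :
    ∀ (A : AbelianVariety ℂ) (φ : A ⟶ A) (n d : ℕ) (e : ProjectiveEmbedding A.X)
      (a : complexBetti (projectiveSpace e.n ℂ) 2),
      2 ≤ n → 0 < d → A.dim = 2 * n → φ ≫ φ = -(d • 𝟙 A) → IsRationalClass a → a ≠ 0 →
      HasHodgeGroupSU A φ n d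
        ((d : ℂ) • complexBetti.map e.ι 2 a + complexBetti.map φ.hom.hom.hom 2 (complexBetti.map e.ι 2 a)) →
      (∀ p : ℕ, p ≤ 2 * n → p ≠ n → Module.finrank ℂ (hodgeClassSpan A.dim A.X p) = 1) ∧
        Module.finrank ℂ (hodgeClassSpan A.dim A.X n) = 3 ∧
        (∀ p : ℕ, p ≠ n → hodgeClassSpan A.dim A.X p = divisorClassesSpan A.X A.dim p) ∧
        hodgeClassSpan A.dim A.X n = divisorClassesSpan A.X A.dim n ⊔ weilClassesOf A φ n d ∧
        Disjoint (divisorClassesSpan A.X A.dim n) (weilClassesOf A φ n d) :=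
  fun A φ n d e a hn hd hA hφ ha ha0 hSU ↦ thm612_of_hasHodgeGroupSU A φ n d e a hn hd hA hφ ha ha0 hSU

end Literature.AlgebraicGeometry.VanGeemen1994

end
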